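import Mathlib
import Summits.ValiantsHypothesis.ValiantsHypothesis.Theorems.BarrierLeverPartitionMinorsHitByVPHiddenStatesPathTableInert
import Summits.ValiantsHypothesis.ValiantsHypothesis.Theorems.BarrierLeverPartitionMinorsHitByVPHiddenStatesPathTableFamily
import Summits.ValiantsHypothesis.ValiantsHypothesis.Theorems.BarrierLeverPartitionMinorsHitByVPHiddenStatesPathTableKOne

/-!
# Route BarrierLever — item `PartitionMinorsHitByVP` (stmt-ValiantsHypothesis-19717), line `hidden-states`:
# ★★ BOUQUETS OF SWAPS OVER A COMMON CORE — `B_t − {X ⊔ Z_l}_l + {Y ⊔ Z_l}_l`, ANY number of swaps, every `t`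

Helper file (`--supports stmt-ValiantsHypothesis-19717`; cell valiant-natproofs, 𝒟-side door (c), registered line
`Cruxes/PartitionMinorsHitByVP/Lines/hidden_states.lean` v8; prover seat val-np-p6 gen 16).  Closes NO item; definition-free.
Memo HOME/val-np-p6/g16/MEMO-valnp6-g16.md §8: the first multi-swap family.  Fix a CORE `X ⊔ Y ⊆ [2t+1]` (`|X| = k ≥ 1`, `|Y| = k+1`,
disjoint) and ANY number of distinct `j`-subsets `Z_l` (`j = t − k`) of the remaining `2j` coordinates.  The down-set
`U = B_t(2t+1) ∖ {X ⊔ Z_l : l} ∪ {Y ⊔ Z_l : l}` (swap distance `m` from the ball) is served by ONE table — the path table on the core,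
identity elsewhere: the functionals `ζ_l(R) = [R_inert = Z_l]·zk(R_core)` annihilate every remaining row and have the DIAGONAL pairing
matrix `Λ_{ζ_l}(Y ⊔ Z_{l'}) = [l = l']·Λ(Y)` (`…PathTableFamily.det_ne_zero_of_dual_family`).
* ★ `det_ne_zero_of_dual_bouquet` — abstract form over `ι₁ ⊕ ι₂`;
* ★★ `exists_table_bouquet` — the cell in the item's currency over `Fin (2t+1)`.

HONEST LABEL: conjecture-column cells (a thin but unbounded-distance family); 19717 OPEN; nothing on crux 14610 or VP ≠ VNP.
-/

set_option linter.dupNamespace false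

namespace Summit.ValiantsHypothesis.ValiantsHypothesis.Theorems.BarrierLever.HiddenStates

open Finset

noncomputable section

namespace PathTable

variable {ι₁ ι₂ : Type} [Fintype ι₁] [DecidableEq ι₁] [Fintype ι₂] [DecidableEq ι₂]

/-- ★ **Bouquets of swaps, abstract form.**  Single-swap dual data on `ι₁`; on `ι₁ ⊕ ι₂` the table is `w₁` on `ι₁`, identity on
`ι₂`; `Zs : Fin m → Finset ι₂` injective with all `|Zs l| = j`.  Rows: injective, each either some `Y₁ ⊔ Zs l` or of size `≤ k + j`
and different from every `X₁ ⊔ Zs l`; columns: all points of size `≤ k + j`.  Then `det ≠ 0`. -/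
theorem det_ne_zero_of_dual_bouquet (w₁ : ι₁ → ι₁ → ℂ) (pot₁ : ι₁ → ℕ)
    (hw₁ : ∀ a q, w₁ a q ≠ 0 → q = a ∨ pot₁ q < pot₁ a) (hdiag₁ : ∀ a, w₁ a a = 1)
    (k : ℕ) (X₁ Y₁ : Finset ι₁) (ζ₁ : Finset ι₁ → ℂ) (hζ₁ : ∀ R, k < R.card → ζ₁ R = 0)
    (hA₁ : ∀ S, S.card ≤ k → S ≠ X₁ →
      ∑ φ ∈ Fintype.piFinset (fun a => if a ∈ S then (Finset.univ : Finset ι₁) else {a}),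
        (∏ a ∈ S, w₁ a (φ a)) * ζ₁ (S.image φ) = 0)
    (hB₁ : ∑ φ ∈ Fintype.piFinset (fun a => if a ∈ Y₁ then (Finset.univ : Finset ι₁) else {a}),
        (∏ a ∈ Y₁, w₁ a (φ a)) * ζ₁ (Y₁.image φ) ≠ 0)
    {m j : ℕ} (Zs : Fin m → Finset ι₂) (hZinj : Function.Injective Zs) (hZcard : ∀ l, (Zs l).card = j)
    (w : ι₁ ⊕ ι₂ → ι₁ ⊕ ι₂ → ℂ) (hw11 : ∀ a q, w (Sum.inl a) (Sum.inl q) = w₁ a q)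
    (hw12 : ∀ a z, w (Sum.inl a) (Sum.inr z) = 0) (hw2 : ∀ z q, w (Sum.inr z) q = if q = Sum.inr z then 1 else 0)
    {r : ℕ} (rowS colJ : Fin r → Finset (ι₁ ⊕ ι₂)) (hinj : Function.Injective rowS)
    (hrow : ∀ i, ((rowS i).card ≤ k + j ∧ ∀ l, rowS i ≠ X₁.disjSum (Zs l)) ∨ ∃ l, rowS i = Y₁.disjSum (Zs l))
    (hcol : ∀ J : Finset (ι₁ ⊕ ι₂), J.card ≤ k + j → ∃ kk, colJ kk = J) :
    (Matrix.of fun i kk : Fin r => ∏ a ∈ rowS i, ∑ q ∈ colJ kk, w a q).det ≠ 0 := by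
  classical
  let ζ : Fin m → Finset (ι₁ ⊕ ι₂) → ℂ := fun l R => if R.toRight = Zs l then ζ₁ R.toLeft else 0
  let pot : ι₁ ⊕ ι₂ → ℕ := Sum.elim pot₁ (fun _ => 0)
  have hw : ∀ a q, w a q ≠ 0 → q = a ∨ pot q < pot a := by
    intro a q h
    rcases a with a₁ | z
    · rcases q with q₁ | z'
      · rw [hw11] at h
        rcases hw₁ a₁ q₁ h with h1 | h1
        · exact Or.inl (by rw [h1])
        · exact Or.inr h1
      · rw [hw12] at h; exact (h rfl).elim
    · rw [hw2] at h
      by_cases hq : q = Sum.inr z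
      · exact Or.inl hq
      · exact (h (if_neg hq)).elim
  have hdiag : ∀ a, w a a = 1 := by
    intro a
    rcases a with a₁ | z
    · rw [hw11, hdiag₁]
    · rw [hw2, if_pos rfl]
  have hfact : ∀ l (S : Finset (ι₁ ⊕ ι₂)),
      ∑ φ ∈ Fintype.piFinset (fun a => if a ∈ S then (Finset.univ : Finset (ι₁ ⊕ ι₂)) else {a}),
          (∏ a ∈ S, w a (φ a)) * ζ l (S.image φ) =
        if S.toRight = Zs l then
          ∑ φ₁ ∈ Fintype.piFinset (fun a => if a ∈ S.toLeft then (Finset.univ : Finset ι₁) else {a}),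
            (∏ a ∈ S.toLeft, w₁ a (φ₁ a)) * ζ₁ (S.toLeft.image φ₁)
        else 0 :=
    fun l S => sum_maps_inert w₁ ζ₁ (Zs l) w hw11 hw12 hw2 (ζ l) (fun R => rfl) S
  let Xs : Finset (Finset (ι₁ ⊕ ι₂)) := (Finset.univ : Finset (Fin m)).image fun l => X₁.disjSum (Zs l)
  let Y : Fin m → Finset (ι₁ ⊕ ι₂) := fun l => Y₁.disjSum (Zs l)
  have hY : Function.Injective Y := by
    intro l l' h
    apply hZinj
    have := congrArg Finset.toRight h
    simpa [Y] using this
  refine det_ne_zero_of_dual_family w pot hw hdiag (k + j) Xs Y hY ζ ?_ ?_ ?_ rowS colJ hinj ?_ hcol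
  · -- support
    intro l R hR
    simp only [ζ]
    split_ifs with hZ
    · apply hζ₁
      have := Finset.card_toLeft_add_card_toRight (u := R)
      rw [hZ, hZcard] at this
      omega
    · rfl
  · -- annihilation
    intro l S hS hX
    rw [hfact l S]
    split_ifs with hZ
    · apply hA₁
      · have := Finset.card_toLeft_add_card_toRight (u := S)
        rw [hZ, hZcard] at this; omega
      · intro hT
        apply hX
        refine Finset.mem_image.2 ⟨l, Finset.mem_univ _, ?_⟩
        rw [← Finset.toLeft_disjSum_toRight (u := S), hT, hZ]
    · rfl
  · -- the pairing matrix is diagonal with entries `Λ₁(Y₁) ≠ 0`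
    have hG : (Matrix.of fun l l' : Fin m =>
        ∑ φ ∈ Fintype.piFinset (fun a => if a ∈ Y l' then (Finset.univ : Finset (ι₁ ⊕ ι₂)) else {a}),
          (∏ a ∈ Y l', w a (φ a)) * ζ l ((Y l').image φ)) =
        Matrix.diagonal fun _ => ∑ φ ∈ Fintype.piFinset (fun a => if a ∈ Y₁ then (Finset.univ : Finset ι₁) else {a}),
          (∏ a ∈ Y₁, w₁ a (φ a)) * ζ₁ (Y₁.image φ) := by
      ext l l'
      rw [Matrix.of_apply, hfact l (Y l')]
      have h1 : (Y l').toRight = Zs l' := by ext; simp [Y]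
      have h2 : (Y l').toLeft = Y₁ := by ext; simp [Y]
      rw [h1, h2]
      by_cases hll : l = l'
      · subst hll; rw [if_pos rfl, Matrix.diagonal_apply_eq]
      · rw [if_neg (fun h => hll (hZinj h.symm)), Matrix.diagonal_apply_ne _ hll]
    rw [hG, Matrix.det_diagonal, Finset.prod_const]
    exact pow_ne_zero _ hB₁
  · intro i
    rcases hrow i with ⟨hc, hne⟩ | ⟨l, hl⟩
    · left
      refine ⟨hc, fun hmem => ?_⟩
      obtain ⟨l, -, hl⟩ := Finset.mem_image.1 hmem
      exact hne l hl.symm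
    · right; exact ⟨l, hl.symm⟩

/-- ★★ **BOUQUETS OF SWAPS OVER A COMMON CORE, in the item's currency.**  Core `X ⊔ Y ⊆ Fin (2t+1)` (`|X| = k ≥ 1`, `|Y| = k + 1`,
disjoint, `k ≤ t`), any injective family of `j`-subsets `Zs l` of `(X ∪ Y)ᶜ` (`j = t − k`): every injective row family ranging in
`B_t ∖ {X ∪ Zs l} ∪ {Y ∪ Zs l}` with columns covering `B_t` is served by a table. -/
theorem exists_table_bouquet (t k : ℕ) (hk : 1 ≤ k) (hkt : k ≤ t) (X Y : Finset (Fin (2 * t + 1)))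
    (hX : X.card = k) (hYc : Y.card = k + 1) (hXY : Disjoint X Y)
    {m : ℕ} (Zs : Fin m → Finset (Fin (2 * t + 1))) (hZinj : Function.Injective Zs)
    (hZsub : ∀ l, Zs l ⊆ (X ∪ Y)ᶜ) (hZcard : ∀ l, (Zs l).card = t - k)
    {r : ℕ} (u cols : Fin r → Finset (Fin (2 * t + 1))) (hu : Function.Injective u)
    (hU : ∀ i, ((u i).card ≤ t ∧ ∀ l, u i ≠ X ∪ Zs l) ∨ ∃ l, u i = Y ∪ Zs l)
    (hcols : ∀ J : Finset (Fin (2 * t + 1)), J.card ≤ t → ∃ kk, cols kk = J) :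
    ∃ tx : Option (Fin (2 * t + 1)) → Fin (2 * t + 1) → ℂ,
      (Matrix.of fun i kk : Fin r => ∏ a ∈ u i, (tx none a + ∑ q ∈ cols kk, tx (some q) a)).det ≠ 0 := by
  classical
  set j := t - k with hj
  -- an auxiliary `j`-subset of the inert coordinates, to fix the re-indexing
  have hIcard : ((X ∪ Y)ᶜ).card = j + j := by
    rw [Finset.card_compl, Finset.card_union_of_disjoint hXY, hX, hYc, Fintype.card_fin]; omega
  obtain ⟨I₁, hI₁sub, hI₁card⟩ : ∃ I₁ ⊆ (X ∪ Y)ᶜ, I₁.card = j :=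
    Finset.exists_subset_card_eq (by rw [hIcard]; omega)
  -- re-index with `A := X ∪ I₁`, `C := Y ∪ I₁`
  have hXI : Disjoint X I₁ := by
    rw [Finset.disjoint_left]; intro a ha hI
    have := Finset.mem_compl.1 (hI₁sub hI); exact this (Finset.mem_union_left _ ha)
  have hYI : Disjoint Y I₁ := by
    rw [Finset.disjoint_left]; intro a ha hI
    have := Finset.mem_compl.1 (hI₁sub hI); exact this (Finset.mem_union_right _ ha)
  have h1 : ((Y ∪ I₁) \ (X ∪ I₁)).card = k + 1 := by
    have : (Y ∪ I₁) \ (X ∪ I₁) = Y := by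
      ext a; simp only [Finset.mem_sdiff, Finset.mem_union, not_or]
      constructor
      · rintro ⟨h, -, hI⟩; exact h.resolve_right hI
      · intro h; exact ⟨Or.inl h, Finset.disjoint_right.1 hXY h, Finset.disjoint_left.1 hYI h⟩
    rw [this, hYc]
  have h2 : ((X ∪ I₁) \ (Y ∪ I₁)).card = k := by
    have : (X ∪ I₁) \ (Y ∪ I₁) = X := by
      ext a; simp only [Finset.mem_sdiff, Finset.mem_union, not_or]
      constructor
      · rintro ⟨h, -, hI⟩; exact h.resolve_right hI
      · intro h; exact ⟨Or.inl h, Finset.disjoint_left.1 hXY h, Finset.disjoint_left.1 hXI h⟩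
    rw [this, hX]
  have h3 : ((X ∪ I₁) ∩ (Y ∪ I₁)).card = j := by
    have : (X ∪ I₁) ∩ (Y ∪ I₁) = I₁ := by
      ext a; simp only [Finset.mem_inter, Finset.mem_union]
      constructor
      · rintro ⟨h | h, h' | h'⟩
        · exact (Finset.disjoint_left.1 hXY h h').elim
        all_goals assumption
      · intro h; exact ⟨Or.inr h, Or.inr h⟩
    rw [this, hI₁card]
  have h4 : ((X ∪ I₁) ∪ (Y ∪ I₁))ᶜ.card = j := by
    have : (X ∪ I₁) ∪ (Y ∪ I₁) = (X ∪ Y) ∪ I₁ := by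
      ext a; simp only [Finset.mem_union]; tauto
    rw [this, Finset.card_compl, Finset.card_union_of_disjoint (Finset.disjoint_union_left.2 ⟨hXI, hYI⟩),
      Finset.card_union_of_disjoint hXY, hX, hYc, hI₁card, Fintype.card_fin]
    omega
  obtain ⟨e, m1, m2, m3, m4⟩ := exists_equiv_four (X ∪ I₁) (Y ∪ I₁) h1 h2 h3 h4
  -- membership of the images
  have meY : ∀ b, e (Sum.inl (Sum.inl b)) ∈ Y := by
    intro b; have h := m1 b
    simp only [Finset.mem_sdiff, Finset.mem_union, not_or] at h
    exact h.1.resolve_right h.2.2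
  have meX : ∀ i, e (Sum.inl (Sum.inr i)) ∈ X := by
    intro i; have h := m2 i
    simp only [Finset.mem_sdiff, Finset.mem_union, not_or] at h
    exact h.1.resolve_right h.2.2
  have meI : ∀ z : Fin j ⊕ Fin j, e (Sum.inr z) ∉ X ∧ e (Sum.inr z) ∉ Y := by
    intro z
    rcases z with z | w'
    · have h := m3 z
      simp only [Finset.mem_inter, Finset.mem_union] at h
      have hzI : e (Sum.inr (Sum.inl z)) ∈ I₁ := by
        rcases h.1 with h' | h'
        · rcases h.2 with h'' | h''
          · exact (Finset.disjoint_left.1 hXY h' h'').elim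
          · exact h''
        · exact h'
      exact ⟨fun hx => Finset.disjoint_left.1 hXI hx hzI, fun hy => Finset.disjoint_left.1 hYI hy hzI⟩
    · have h := m4 w'
      simp only [Finset.mem_compl, Finset.mem_union, not_or] at h
      exact ⟨h.1.1, h.2.1⟩
  -- the table: path table on the core, identity on the inert block
  let w : (Fin (k + 1) ⊕ Fin k) ⊕ (Fin j ⊕ Fin j) → (Fin (k + 1) ⊕ Fin k) ⊕ (Fin j ⊕ Fin j) → ℂ :=
    fun a q => match a, q with
      | Sum.inl a₁, Sum.inl q₁ => pw k 1 a₁ q₁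
      | Sum.inl _, Sum.inr _ => 0
      | Sum.inr z, q => if q = Sum.inr z then 1 else 0
  -- pulled-back data
  let Zs' : Fin m → Finset (Fin j ⊕ Fin j) := fun l => ((Zs l).map e.symm.toEmbedding).toRight
  let rowS : Fin r → Finset ((Fin (k + 1) ⊕ Fin k) ⊕ (Fin j ⊕ Fin j)) := fun i => (u i).map e.symm.toEmbedding
  let colJ : Fin r → Finset ((Fin (k + 1) ⊕ Fin k) ⊕ (Fin j ⊕ Fin j)) := fun kk => (cols kk).map e.symm.toEmbedding
  have hZ'mem : ∀ l z, z ∈ Zs' l ↔ e (Sum.inr z) ∈ Zs l := by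
    intro l z; simp only [Zs', Finset.mem_toRight, Finset.mem_map_equiv, Equiv.symm_symm]
  have hmapX : ∀ l, (X ∪ Zs l).map e.symm.toEmbedding = ((Finset.univ : Finset (Fin k)).image Sum.inr).disjSum (Zs' l) := by
    intro l; ext x
    rw [Finset.mem_map_equiv, Equiv.symm_symm, Finset.mem_union]
    rcases x with (b | i) | z
    · simp only [Finset.inl_mem_disjSum, Finset.mem_image, Finset.mem_univ, true_and]
      constructor
      · rintro (h | h)
        · exact (Finset.disjoint_left.1 hXY h (meY b)).elim
        · exact ((Finset.mem_compl.1 (hZsub l h)) (Finset.mem_union_right _ (meY b))).elim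
      · rintro ⟨_, h⟩; cases h
    · simp only [Finset.inl_mem_disjSum, Finset.mem_image, Finset.mem_univ, true_and]
      exact ⟨fun _ => ⟨i, rfl⟩, fun _ => Or.inl (meX i)⟩
    · rw [Finset.inr_mem_disjSum, hZ'mem]
      constructor
      · rintro (h | h)
        · exact ((meI z).1 h).elim
        · exact h
      · intro h; exact Or.inr h
  have hmapY : ∀ l, (Y ∪ Zs l).map e.symm.toEmbedding = ((Finset.univ : Finset (Fin (k + 1))).image Sum.inl).disjSum (Zs' l) := by
    intro l; ext x
    rw [Finset.mem_map_equiv, Equiv.symm_symm, Finset.mem_union]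
    rcases x with (b | i) | z
    · simp only [Finset.inl_mem_disjSum, Finset.mem_image, Finset.mem_univ, true_and]
      exact ⟨fun _ => ⟨b, rfl⟩, fun _ => Or.inl (meY b)⟩
    · simp only [Finset.inl_mem_disjSum, Finset.mem_image, Finset.mem_univ, true_and]
      constructor
      · rintro (h | h)
        · exact (Finset.disjoint_left.1 hXY (meX i) h).elim
        · exact ((Finset.mem_compl.1 (hZsub l h)) (Finset.mem_union_left _ (meX i))).elim
      · rintro ⟨_, h⟩; cases h
    · rw [Finset.inr_mem_disjSum, hZ'mem]
      constructor
      · rintro (h | h)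
        · exact ((meI z).2 h).elim
        · exact h
      · intro h; exact Or.inr h
  have hZ'inj : Function.Injective Zs' := by
    intro l l' h
    apply hZinj
    have h' : (((Finset.univ : Finset (Fin (k + 1))).image Sum.inl).disjSum (Zs' l) : Finset ((Fin (k + 1) ⊕ Fin k) ⊕ (Fin j ⊕ Fin j))) =
        ((Finset.univ : Finset (Fin (k + 1))).image Sum.inl).disjSum (Zs' l') := by rw [h]
    rw [← hmapY l, ← hmapY l'] at h'
    have := Finset.map_injective _ h'
    -- `Y ∪ Zs l = Y ∪ Zs l'` with both `Zs` disjoint from `Y`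
    ext a
    have hl := hZsub l; have hl' := hZsub l'
    constructor
    · intro ha
      have : a ∈ Y ∪ Zs l' := by rw [← this]; exact Finset.mem_union_right _ ha
      rcases Finset.mem_union.1 this with h1 | h1
      · exact ((Finset.mem_compl.1 (hl ha)) (Finset.mem_union_right _ h1)).elim
      · exact h1
    · intro ha
      have : a ∈ Y ∪ Zs l := by rw [this]; exact Finset.mem_union_right _ ha
      rcases Finset.mem_union.1 this with h1 | h1
      · exact ((Finset.mem_compl.1 (hl' ha)) (Finset.mem_union_right _ h1)).elim
      · exact h1
  have hZ'card : ∀ l, (Zs' l).card = j := by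
    intro l
    have hsum := Finset.card_toLeft_add_card_toRight (u := (Zs l).map e.symm.toEmbedding)
    have hleft : ((Zs l).map e.symm.toEmbedding).toLeft = ∅ := by
      rw [Finset.eq_empty_iff_forall_notMem]
      intro x hx
      rw [Finset.mem_toLeft, Finset.mem_map_equiv, Equiv.symm_symm] at hx
      have hc := Finset.mem_compl.1 (hZsub l hx)
      rcases x with b | i
      · exact hc (Finset.mem_union_right _ (meY b))
      · exact hc (Finset.mem_union_left _ (meX i))
    rw [hleft, Finset.card_empty, zero_add, Finset.card_map, hZcard] at hsum
    exact hsum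
  have hinj : Function.Injective rowS := fun i i' hij => hu (Finset.map_injective _ hij)
  have hrow : ∀ i, ((rowS i).card ≤ k + j ∧ ∀ l, rowS i ≠ ((Finset.univ : Finset (Fin k)).image Sum.inr).disjSum (Zs' l)) ∨
      ∃ l, rowS i = ((Finset.univ : Finset (Fin (k + 1))).image Sum.inl).disjSum (Zs' l) := by
    intro i
    rcases hU i with ⟨hc, hne⟩ | ⟨l, hl⟩
    · left
      refine ⟨by simp only [rowS, Finset.card_map]; omega, fun l h => hne l ?_⟩
      rw [← hmapX l] at h
      exact Finset.map_injective _ h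
    · right; exact ⟨l, by simp only [rowS, hl, hmapY]⟩
  have hcol : ∀ J : Finset ((Fin (k + 1) ⊕ Fin k) ⊕ (Fin j ⊕ Fin j)), J.card ≤ k + j → ∃ kk, colJ kk = J := by
    intro J hJ
    obtain ⟨kk, hkk⟩ := hcols (J.map e.toEmbedding) (by rw [Finset.card_map]; omega)
    refine ⟨kk, ?_⟩
    simp only [colJ, hkk, Finset.map_map]
    convert Finset.map_refl (s := J)
    ext x; simp
  have hdet := det_ne_zero_of_dual_bouquet (pw k 1) (ppot k) (pw_ne_zero k 1) (pw_self k 1) k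
    ((Finset.univ : Finset (Fin k)).image Sum.inr) ((Finset.univ : Finset (Fin (k + 1))).image Sum.inl) (zk k 1)
    (fun R hR => zk_card_ne (by omega)) (fun S hS hX => lambda_row_eq_zero S hS hX) (lambda_Y_ne_zero' hk one_ne_zero)
    Zs' hZ'inj hZ'card w (fun _ _ => rfl) (fun _ _ => rfl) (fun _ _ => rfl) rowS colJ hinj hrow hcol
  refine ⟨fun o a => match o with | none => 0 | some q => w (e.symm a) (e.symm q), ?_⟩
  convert hdet using 2
  ext i kk
  simp only [Matrix.of_apply, zero_add, rowS, colJ, Finset.prod_map, Finset.sum_map]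
  rfl

end PathTable

end

end Summit.ValiantsHypothesis.ValiantsHypothesis.Theorems.BarrierLever.HiddenStates
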